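import Literature.Computability.QuantumComplexity.HidingSolver
import Literature.Computability.QuantumComplexity.HidingGoodEvent
import HarnessLib

/-!
# The proof of AA13 Thm. 1.3: from the machine's coins to the ideal world (the symmetry step)

Family `quantum-advantage`, sequel of `HidingSolver.lean` (the machine's answer on structured data,
`postFun_eq_zStruct`) and `HidingGoodEvent.lean` (the good event of the ideal world and its
probability). This file performs the COUNTING step of the discharge of Aaronson–Arkhipov's Thm. 1.3
between them — AA13's symmetry argument "we could have equally well generated the pair `⟨X, A⟩` by
first sampling `A` and then setting `X := √m A_{S*}`" (p. 194) in the tree's finite form: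

* the coin string `r = r_S r_B u` decodes bijectively into positions `S`, a coin array `B_c` and
  the counter's coins (`card_filter_vector_add`, `finTuple`/`matChunk` bijections);
* planting the coin rows of `X̃` into `B_c` at `S` gives an array `W` which, for uniform
  `(X̃-coins, S, B_c)`, is uniform and INDEPENDENT of `S` (`card_overwrite_positions_eq`);
  `overwrite` commutes with reading the entries (`entryArr_overwrite`) and returns the planted row
  at an injective position (`overwrite_apply_of_injective`);
* on the good event of `(S, W, u)` the machine's answer is accurate (`postFun_eq_zStruct` +
  `good_answer_bound`), so **`card_fail_le`**: the number of `(X̃-coins, r)` on which the answer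
  misses `|Per(X̃/2ᵇ)|²` by more than `n!/(2kε)` is at most `|A|^{n²} ·` (the union bound of
  `card_not_idealGood_le`) `· #Ω` — the count that `sum_real_roundEvent_le` (the real-to-ideal
  domination) asks for.

All proved, no new named facts.

## References

* S. Aaronson, A. Arkhipov, *The computational complexity of linear optics*, Theory of Computing 9
  (2013) 143–252, proof of Thm. 1.3, §5.2 (pp. 192–195), esp. the symmetry argument (p. 194).
-/

noncomputable section

namespace Literature.Computability.QuantumComplexity

open Finset Matrix Polynomial Literature.Computability.Complexity Literature.Computability.Complexity.CodeFP
  Literature.Computability.Cryptography Literature.Probability.Distributions Literature.Probability.Moments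
  Literature.LinearAlgebra.Matrix Literature.Analysis.Matrix Literature.Algebra.EuclideanLattices
  Literature.Combinatorics.Enumerative

/-! ### Counting helpers -/

/-- Transport of a count along a bijection. [folklore] -/
theorem card_filter_comp_of_bijective {α β : Type*} [Fintype α] [Fintype β] (φ : α → β) (hφ : Function.Bijective φ)
    (Q : β → Prop) [DecidablePred Q] :
    (univ.filter fun a => Q (φ a)).card = (univ.filter Q).card := by
  refine card_bij (fun a _ => φ a) (fun a ha => by simpa using ha) (fun a _ b _ h => hφ.1 h) fun b hb => ?_
  obtain ⟨a, rfl⟩ := hφ.2 b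
  exact ⟨a, by simpa using hb, rfl⟩

/-- Monotonicity of counts under implication. [folklore] -/
theorem card_filter_le_of_imp {α : Type*} [Fintype α] {Q R : α → Prop} [DecidablePred Q] [DecidablePred R]
    (h : ∀ a, Q a → R a) : (univ.filter Q).card ≤ (univ.filter R).card :=
  card_le_card fun a ha => by
    simp only [mem_filter, mem_univ, true_and] at ha ⊢
    exact h a ha

/-- A count over a product, summed over the second coordinate. [folklore] -/
theorem card_filter_prod_eq_sum_snd {α β : Type*} [Fintype α] [Fintype β] (Q : α → β → Prop) [∀ a b, Decidable (Q a b)] :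
    (univ.filter fun p : α × β => Q p.1 p.2).card = ∑ b, (univ.filter fun a => Q a b).card := by
  classical
  rw [card_filter, Fintype.sum_prod_type, Finset.sum_comm]
  refine Finset.sum_congr rfl fun b _ => ?_
  rw [card_filter]

/-- Splitting a coin string of length `a + b` into its two fields (an equivalence). [folklore] -/
def vecAppendEquiv (a b : ℕ) : List.Vector Bool a × List.Vector Bool b ≃ List.Vector Bool (a + b) where
  toFun q := ⟨q.1.toList ++ q.2.toList, by simp⟩
  invFun v := (⟨v.toList.take a, by simp⟩, ⟨v.toList.drop a, by simp⟩)
  left_inv q := by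
    obtain ⟨⟨u, hu⟩, ⟨w, hw⟩⟩ := q
    refine Prod.ext (Subtype.ext ?_) (Subtype.ext ?_)
    · show List.take a (u ++ w) = u
      exact List.take_left' hu
    · show List.drop a (u ++ w) = w
      exact List.drop_left' hu
  right_inv v := by
    apply Subtype.ext
    show List.take a v.toList ++ List.drop a v.toList = v.toList
    exact List.take_append_drop a v.toList

/-- **A count over coin strings of length `a + b` is a count over pairs of fields.** [folklore] -/
theorem card_filter_vector_add (a b : ℕ) (Q : List Bool → Prop) [DecidablePred Q] :
    (univ.filter fun v : List.Vector Bool (a + b) => Q v.toList).card =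
      (univ.filter fun q : List.Vector Bool a × List.Vector Bool b => Q (q.1.toList ++ q.2.toList)).card := by
  rw [← card_filter_comp_of_bijective (vecAppendEquiv a b) (vecAppendEquiv a b).bijective (fun v => Q v.toList)]
  rfl

/-! ### `overwrite`: reading entries, and the planted rows at injective positions -/

variable {m n : ℕ}

/-- **`overwrite` commutes with a map of the rows.** [folklore] -/
theorem overwrite_map {β γ : Type*} (g : β → γ) (r : Fin m → β) (S : Fin n → Fin m) (x : Fin n → β) (ρ : Fin m) :
    g (overwrite r S x ρ) = overwrite (fun ρ => g (r ρ)) S (fun i => g (x i)) ρ := by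
  unfold overwrite
  rw [foldl_update_apply S x (List.finRange n) r ρ, foldl_update_apply S (fun i => g (x i)) (List.finRange n) (fun ρ => g (r ρ)) ρ]
  exact (foldl_ite_map g (fun i => S i = ρ) x (List.finRange n) (r ρ)).symm

/-- A fold that picks the value at a given index. [folklore] -/
theorem foldl_ite_eq_index {β : Type*} (x : Fin n → β) (i : Fin n) : ∀ (L : List (Fin n)) (a : β), L.Nodup →
    L.foldl (fun acc k => if k = i then x k else acc) a = if i ∈ L then x i else a
  | [], a, _ => by simp
  | k :: L, a, hnd => by
    rw [List.foldl_cons, foldl_ite_eq_index x i L _ (List.nodup_cons.1 hnd).2]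
    by_cases hk : k = i
    · subst hk
      have : k ∉ L := (List.nodup_cons.1 hnd).1
      simp [this]
    · simp [hk, Ne.symm hk]

/-- **At an injective position the planted row is returned**: `overwrite r S x (S i) = x i`. [folklore] -/
theorem overwrite_apply_of_injective {β : Type*} (r : Fin m → β) {S : Fin n → Fin m} (hS : Function.Injective S)
    (x : Fin n → β) (i : Fin n) : overwrite r S x (S i) = x i := by
  unfold overwrite
  rw [foldl_update_apply S x (List.finRange n) r (S i)]
  have h : (fun (a : β) (k : Fin n) => if S k = S i then x k else a) = fun a k => if k = i then x k else a := by
    funext a k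
    simp only [hS.eq_iff]
  rw [h, foldl_ite_eq_index x i (List.finRange n) (r (S i)) (List.nodup_finRange n), if_pos (List.mem_finRange i)]

/-! ### Reading the entries of coin arrays -/

variable (P : PGParams)

/-- Reading a row of entry blocks. [folklore] -/
def rowEntries (row : Fin n → EntryBlock P) (j : Fin n) : ℤ × ℤ := entryOfCoins P (row j).toList

/-- `entryArr` reads the rows. [folklore] -/
theorem entryArr_eq (W : Fin m → Fin n → EntryBlock P) : entryArr P W = fun r => rowEntries P (W r) := rfl

/-- `arrOfCoins` is `entryArr` of the chunked coins. [folklore] -/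
theorem arrOfCoins_eq (v : List.Vector Bool (m * (n * (2 * P.coinLen)))) : arrOfCoins P v = entryArr P (matChunk v) := rfl

/-- `rowsOfCoins` is `entryArr` of the chunked coins. [folklore] -/
theorem rowsOfCoins_eq (v : List.Vector Bool (n * (n * (2 * P.coinLen)))) : rowsOfCoins P v = entryArr P (matChunk v) := rfl

/-- **Planting commutes with reading the entries.** [folklore] -/
theorem entryArr_overwrite (Bc : Fin m → Fin n → EntryBlock P) (S : Fin n → Fin m) (xc : Fin n → Fin n → EntryBlock P) :
    entryArr P (overwrite Bc S xc) = overwrite (entryArr P Bc) S (entryArr P xc) := by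
  funext ρ
  exact overwrite_map (rowEntries P) Bc S xc ρ

/-! ### The two black boxes as `IdealParams`, and the failure event -/

section Main

variable (H : HPolys) (p₀ cO cS : Polynomial ℕ) (F : List Bool → List Bool) (O : Oracle)

/-- The parameters of the two black boxes at `N = n + kε + kδ` with `LU` counter coins: the oracle
`𝒪` with coin polynomial `c_𝒪`, queried at precision `b_q(N)` and accuracy `kβ(N)`; the counter `F`
with coin polynomial `c_S`, accuracy `kη(N)`, confidence `kδS(N)`. [cite: AaronsonArkhipovToC2013, proof of Thm. 1.3 (pp. 193–194)] -/
def idealP (N LU : ℕ) : IdealParams := ⟨O, cO, H.bq p₀ N, H.kβ N, F, cS, H.kη N, H.kδS N, LU⟩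

/-- **The failure event on the rounded input and the coins**: the machine's answer misses
`|Per(X̃/2ᵇ)|²` by more than `n!/(2kε)`. [cite: AaronsonArkhipovToC2013, proof of Thm. 1.3, eq. (5.96) (p. 195)] -/
def FailEv (n b kε kδ : ℕ) (x : Fin n → Fin n → ℤ × ℤ) (r : List Bool) : Prop :=
  (n.factorial : ℝ) / (2 * kε) <
    |(postFun H p₀ cO (((n, b, kε, kδ, rowsOf x), r), F (preFun H p₀ cO cS ((n, b, kε, kδ, rowsOf x), r))) : ℝ) / 4 ^ b -
      ‖(_root_.Matrix.of fun i j => dyadicComplex b (x i j)).permanent‖ ^ 2|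

variable {n e kε kδ b N LU : ℕ}

/-- The positions decoded from the position field. [folklore] -/
def posDec (he : H.m N = n + e) (vS : List.Vector Bool (n * H.μ N)) (i : Fin n) : Fin (n + e) := Fin.cast he (finTuple vS i)

/-- The position decoding is a bijection. [folklore] -/
theorem posDec_bijective (he : H.m N = n + e) : Function.Bijective (posDec H (n := n) he) := by
  have h1 : Function.Bijective (fun (f : Fin n → Fin (2 ^ H.μ N)) (i : Fin n) => Fin.cast he (f i)) :=
    Function.Bijective.comp_left (g := Fin.cast he) (finCongr he).bijective
  exact h1.comp (finTuple_bijective n (H.μ N))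

/-- **The error term of the good event** (`core_answer_bound`) with the Markov thresholds:
`[(2P+Z)Z + (P² + (2P+Z)Z)/kη + n!((1+t) m s)ⁿ θ₂ (1+1/kη)]/4^{bn} + 4^{-b}`, `s = 2·4ᵇ·v`,
`θ₂ = (ε₀/2)/mⁿ`. [cite: AaronsonArkhipovToC2013, proof of Thm. 1.3, eqs. (5.93)–(5.95) (p. 195)] -/
def errTerm (P : PGParams) (n m kη : ℕ) (t Z Pr ε₀ : ℝ) : ℝ :=
  ((2 * Pr + Z) * Z + (Pr ^ 2 + (2 * Pr + Z) * Z) / kη +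
      n.factorial * ((1 + t) * ((m : ℝ) * (2 * 4 ^ P.b * P.v))) ^ n * (ε₀ / 2 / (m : ℝ) ^ n) * (1 + 1 / kη)) /
    4 ^ (P.b * n) + 1 / 4 ^ P.b

open Classical in
/-- **The counting step.** With `P = pg b N` the sampler parameters, `Ω` the ideal sample space at
`LU = ℓ₂` counter coins and the hypotheses of the union bound (`card_not_idealGood_le`), a polynomial
bound `stockLenB ≤ LU` on the counter's coin demand and an error term `≤ n!/(2kε)`, the number of
pairs `(X̃-coins, r)`, `r = r_S r_B u`, on which the machine's answer misses `|Per(X̃/2ᵇ)|²` by more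
than `n!/(2kε)` is at most `|A|^{n²} · (union bound) · #Ω`. [cite: AaronsonArkhipovToC2013, proof of Thm. 1.3, §5.2 (pp. 192–195)] -/
theorem card_fail_le (hN : n + kε + kδ = N) (hn : 0 < n) (he : H.m N = n + e) [NeZero (n + e)]
    (hNr : N ≤ n * H.μ N + (n + e) * (n * (2 * (H.pg b N).coinLen)) + LU)
    (hbr : b ≤ n * H.μ N + (n + e) * (n * (2 * (H.pg b N).coinLen)) + LU)
    {t Z Pr ε₀ δ₀ M4 : ℝ} (ht : 0 < t) (htn : 8 * t * n ≤ 1) (ht4 : t ≤ 1 / 4) (htn' : t * n < 1)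
    (htn3 : 8 * t * (n : ℝ) ^ 3 ≤ 1) (hZ : 0 < Z) (hPr : 0 < Pr) (hε : 0 < ε₀) (hδ : 0 ≤ δ₀) (hne : 3 * n ^ 2 ≤ n + e)
    (hs : 0 < 2 * (4 : ℝ) ^ (H.pg b N).b * (H.pg b N).v) (hM4 : ∑ a, unifW (H.pg b N) a * ‖yOf (H.pg b N) a‖ ^ 4 = M4)
    (hkη : 0 < H.kη N) (hδS : 0 < H.kδS N)
    (hO : ∀ W : Fin (n + e) → Fin n → EntryBlock (H.pg b N), GramGood (H.pg b N) t (2 * 4 ^ (H.pg b N).b * (H.pg b N).v) W →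
      (lawArr (H.pg b N) (idealP H p₀ cO cS F O N LU) W).tvDist (bosonTargetPMF (uMat (H.pg b N) W)) ≤ ε₀ * δ₀ / 24)
    (hSt : ∀ (x : List Bool) (ℓ : ℕ),
      uniformProb (cS.eval (x.length + ℓ + H.kη N + H.kδS N))
        {u | ¬ IsApproxCount (H.kη N) (countWitnesses (samplerRel (oracleRandAlg O cO)) ℓ x)
          (countEstimate F x ℓ (H.kη N) (H.kδS N) u)} ≤ 1 / (H.kδS N : ℝ))
    (hLU : stockLenB cO cS n (n + e) (H.bq p₀ N) (H.kβ N) (H.kη N) (H.kδS N) ≤ LU)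
    (hErr : errTerm (H.pg b N) n (n + e) (H.kη N) t Z Pr ε₀ ≤ (n.factorial : ℝ) / (2 * kε)) :
    ((univ.filter fun q : List.Vector Bool (n * (n * (2 * (H.pg b N).coinLen))) ×
        List.Vector Bool (n * H.μ N + (n + e) * (n * (2 * (H.pg b N).coinLen)) + LU) =>
        FailEv H p₀ cO cS F n b kε kδ (rowsOfCoins (H.pg b N) q.1) q.2.toList).card : ℝ) ≤
      (Fintype.card (EntryBlock (H.pg b N)) : ℝ) ^ (n * n) *
        (((n : ℝ) ^ 2 / (n + e : ℕ) +
          (n : ℝ) ^ 2 * (4 * (n + e : ℕ) * (M4 + (2 * 4 ^ (H.pg b N).b * (H.pg b N).v) ^ 2)) /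
            (t * ((n + e : ℕ) * (2 * 4 ^ (H.pg b N).b * (H.pg b N).v))) ^ 2 +
          4 * (8 * t) ^ 2 * (n : ℝ) ^ 6 * ((2 * 4 ^ (H.pg b N).b * (H.pg b N).v) ^ n * n.factorial) / Z ^ 2 +
          (2 * 4 ^ (H.pg b N).b * (H.pg b N).v) ^ n * n.factorial / Pr ^ 2 + δ₀ / 4 + 1 / (H.kδS N : ℝ)) *
        Fintype.card (IdealΩ (idealP H p₀ cO cS F O N LU) (H.pg b N) n e)) := by
  -- abbreviations
  set P := H.pg b N with hP
  set IP := idealP H p₀ cO cS F O N LU with hIP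
  set θ₂ : ℝ := ε₀ / 2 / ((n + e : ℕ) : ℝ) ^ n with hθ
  have hPb : P.b = b := rfl
  have hN₀ : 0 < ((n + e : ℕ) : ℝ) * (2 * 4 ^ P.b * P.v) := by
    have : 0 < n + e := Nat.pos_of_ne_zero (NeZero.ne _)
    positivity
  -- the types
  let A : Type := EntryBlock P
  let VS : Type := List.Vector Bool (n * H.μ N)
  let VB : Type := List.Vector Bool ((n + e) * (n * (2 * P.coinLen)))
  let VU : Type := List.Vector Bool LU
  let VX : Type := List.Vector Bool (n * (n * (2 * P.coinLen)))
  let X : Type := Fin n → Fin n → A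
  let Y : Type := (Fin n → Fin (n + e)) × (Fin (n + e) → Fin n → A)
  -- Step 1: the coin string as three fields
  let ψ : (VS × VB) × VU → List.Vector Bool (n * H.μ N + (n + e) * (n * (2 * P.coinLen)) + LU) :=
    fun t => vecAppendEquiv _ _ (Prod.map (vecAppendEquiv _ _) id t)
  have hψ : Function.Bijective ψ :=
    (vecAppendEquiv _ _).bijective.comp (Function.Bijective.prodMap (vecAppendEquiv _ _).bijective Function.bijective_id)
  let Φ : (VX × (VS × VB)) × VU → VX × List.Vector Bool (n * H.μ N + (n + e) * (n * (2 * P.coinLen)) + LU) :=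
    fun q => Prod.map id ψ (Equiv.prodAssoc VX (VS × VB) VU q)
  have hΦ : Function.Bijective Φ :=
    (Function.Bijective.prodMap Function.bijective_id hψ).comp (Equiv.prodAssoc VX (VS × VB) VU).bijective
  rw [← card_filter_comp_of_bijective Φ hΦ]
  -- Step 2: on the good event of the decoded data the answer is accurate
  let Ψ : (VX × (VS × VB)) × VU → (X × Y) × VU :=
    Prod.map (Prod.map (matChunk (m := n) (n := n) (A := 2 * P.coinLen))
      (Prod.map (posDec H he) (matChunk (m := n + e) (n := n) (A := 2 * P.coinLen)))) id
  have hΨ : Function.Bijective Ψ :=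
    Function.Bijective.prodMap (Function.Bijective.prodMap (matChunk_bijective _ _ _)
      (Function.Bijective.prodMap (posDec_bijective H he) (matChunk_bijective _ _ _))) Function.bijective_id
  let G : (X × Y) × VU → IdealΩ IP P n e := fun w => ((w.1.2.1, overwrite w.1.2.2 w.1.2.1 w.1.1), w.2)
  have himp : ∀ q : (VX × (VS × VB)) × VU,
      (fun q' : VX × List.Vector Bool (n * H.μ N + (n + e) * (n * (2 * P.coinLen)) + LU) =>
        FailEv H p₀ cO cS F n b kε kδ (rowsOfCoins P q'.1) q'.2.toList) (Φ q) →
      (fun w => ¬ IdealGood IP P t Z (Pr ^ 2) θ₂ (G w)) (Ψ q) := by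
    rintro ⟨⟨xc, vS, vB⟩, u⟩ hE hgood
    have hE' : FailEv H p₀ cO cS F n b kε kδ (rowsOfCoins P xc) (vS.toList ++ vB.toList ++ u.toList) := hE
    -- the planted array and its entries
    set S : Fin n → Fin (n + e) := posDec H he vS with hS
    set W : Fin (n + e) → Fin n → A := overwrite (matChunk vB) S (matChunk xc) with hW
    have hgood' : IdealGood IP P t Z (Pr ^ 2) θ₂ ((S, W), u) := hgood
    obtain ⟨hinj, hG, hpS, hPer, hΔ, hStock⟩ := hgood'
    have hWE : entryArr P W = overwrite (arrOfCoins P vB) S (rowsOfCoins P xc) := by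
      rw [hW, entryArr_overwrite, arrOfCoins_eq, rowsOfCoins_eq]
    have hli : LinearIndependent ℂ (colVec (gaussIntMatrix (overwrite (arrOfCoins P vB) S (rowsOfCoins P xc)))) := by
      rw [← hWE]
      exact linearIndependent_colVec_gaussIntMatrix_of_gram hG.hG hN₀ htn'
    -- the machine's answer is the structured answer
    have hlen : (vS.toList ++ vB.toList ++ u.toList).length = n * H.μ N + (n + e) * (n * (2 * P.coinLen)) + LU := by
      simp only [List.length_append, List.Vector.toList_length]
    have hz := postFun_eq_zStruct H p₀ cO cS F hN hn he (rowsOfCoins P xc) vS vB u.toList S rfl (arrOfCoins P vB) rfl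
      (by rw [hlen]; exact hNr) (by rw [hlen]; exact hbr) hli
    rw [FailEv, hz, zStruct, ← hWE] at hE'
    -- the planted rows are the rows of `X̃`
    have hrows : (fun i j => dyadicComplex b (rowsOfCoins P xc i j)) = fun i j => dyadicComplex P.b (entryArr P W (S i) j) := by
      funext i j
      rw [hWE, overwrite_apply_of_injective _ hinj]
      rfl
    rw [hrows] at hE'
    -- the good event gives accuracy
    have hPr' : ‖((yMat P W).submatrix S id).permanent‖ ≤ Pr := (lt_of_pow_lt_pow_left₀ 2 hPr.le hPer).le
    have hkηIP : 0 < IP.kη := hkη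
    have hSt' : IsApproxCount IP.kη (IP.plantedCount (eArr P IP W) ⟨S, hinj⟩)
        (IP.plantedCountEstimate (eArr P IP W) ⟨S, hinj⟩ u.toList) := by
      by_contra h'
      exact hStock hinj ⟨(stockCoinLen_hiddenOf_le IP (entryArr P W) ⟨S, hinj⟩).trans hLU, h'⟩
    have hacc := good_answer_bound IP P W hinj u.toList hG hs ht.le htn ht4 htn' hpS.le hPr' hkηIP (hΔ hinj) hSt'
    have hfin : |(zArr IP.c IP.cS IP.F P.b IP.b' IP.kβ IP.kη IP.kδS (entryArr P W) S u.toList : ℝ) / 4 ^ P.b -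
        ‖(_root_.Matrix.of fun i j => dyadicComplex P.b (entryArr P W (S i) j)).permanent‖ ^ 2| ≤
        (n.factorial : ℝ) / (2 * kε) := hacc.trans hErr
    exact absurd hE' (not_lt.2 hfin)
  refine (Nat.cast_le.2 (card_filter_le_of_imp himp)).trans ?_
  -- Step 3: decode, a bijection onto `(X × Y) × VU`
  rw [card_filter_comp_of_bijective Ψ hΨ (fun w => ¬ IdealGood IP P t Z (Pr ^ 2) θ₂ (G w))]
  -- Step 4: the symmetry step, for each counter coin block
  have hsym : (univ.filter fun w : (X × Y) × VU => ¬ IdealGood IP P t Z (Pr ^ 2) θ₂ (G w)).card =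
      Fintype.card (Fin n → A) ^ n * (univ.filter fun q : IdealΩ IP P n e => ¬ IdealGood IP P t Z (Pr ^ 2) θ₂ q).card := by
    have h1 : (univ.filter fun w : (X × Y) × VU => ¬ IdealGood IP P t Z (Pr ^ 2) θ₂ (G w)).card =
        ∑ u : VU, (univ.filter fun y : X × Y => ¬ IdealGood IP P t Z (Pr ^ 2) θ₂ ((y.2.1, overwrite y.2.2 y.2.1 y.1), u)).card :=
      card_filter_prod_eq_sum_snd (fun (y : X × Y) (u : VU) => ¬ IdealGood IP P t Z (Pr ^ 2) θ₂ ((y.2.1, overwrite y.2.2 y.2.1 y.1), u))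
    have h2 : (univ.filter fun q : IdealΩ IP P n e => ¬ IdealGood IP P t Z (Pr ^ 2) θ₂ q).card =
        ∑ u : VU, (univ.filter fun y : Y => ¬ IdealGood IP P t Z (Pr ^ 2) θ₂ (y, u)).card :=
      card_filter_prod_eq_sum_snd (fun (y : Y) (u : VU) => ¬ IdealGood IP P t Z (Pr ^ 2) θ₂ (y, u))
    have h3 : ∀ u : VU, (univ.filter fun y : X × Y => ¬ IdealGood IP P t Z (Pr ^ 2) θ₂ ((y.2.1, overwrite y.2.2 y.2.1 y.1), u)).card =
        Fintype.card (Fin n → A) ^ n * (univ.filter fun y : Y => ¬ IdealGood IP P t Z (Pr ^ 2) θ₂ (y, u)).card := fun u =>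
      card_overwrite_positions_eq (β := Fin n → A) (m := n + e) (n := n) (fun W S => ¬ IdealGood IP P t Z (Pr ^ 2) θ₂ ((S, W), u))
    rw [h1, h2, Finset.mul_sum]
    exact Finset.sum_congr rfl fun u _ => h3 u
  rw [hsym, Nat.cast_mul, Nat.cast_pow, Fintype.card_fun, Fintype.card_fin, Nat.cast_pow, ← pow_mul]
  -- Step 5: the union bound
  have hgood := card_not_idealGood_le IP P ht htn3 hZ (by positivity : 0 < Pr ^ 2) hε hδ hne (Nat.pos_of_ne_zero (NeZero.ne _))
    hs hM4 hδS hO hSt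
  exact mul_le_mul_of_nonneg_left hgood (by positivity)

end Main

end Literature.Computability.QuantumComplexity
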